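import Literature.Geometry.Symplectic.JHolomorphicLocalIntersections
import Literature.Geometry.Symplectic.DbarInequalityZeroDichotomy
import Summits.SmoothPoincare4.SmoothPoincare4.Theorems.SullivanDualWitnessChargeHelperJHolomorphicChart
import Summits.SmoothPoincare4.SmoothPoincare4.Theorems.SullivanDualWitnessChargeHelperChartJ
import Summits.SmoothPoincare4.SmoothPoincare4.Theorems.SullivanDualWitnessChargeHelperInTangentCoordinatesContMDiffOn
import Summits.SmoothPoincare4.SmoothPoincare4.Theorems.SullivanDualWitnessChargeHelperStraightenFlatDisc
import Summits.SmoothPoincare4.SmoothPoincare4.Theorems.SullivanDualWitnessChargeHelperNormalComponentInequality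
import Mathlib.Analysis.Complex.OpenMapping
import Mathlib.Analysis.Complex.CauchyIntegral
import Mathlib.Topology.OpenPartialHomeomorph.Basic
import Mathlib.Analysis.Calculus.FDeriv.Equiv
import Mathlib.Analysis.Calculus.ContDiff.Operations

/-!
# Fact F3 (intersection dichotomy for `J`-curves) from the `∂̄`-inequality zero dichotomy

Crux `WitnessCharge` (stmt-SmoothPoincare4-7824), line `Sketch`, continuation lead c5 (cycle 5).
`Literature.Geometry.Symplectic.jHolomorphic_intersectionDichotomy` (McDuff 1991 Lemma 2.7: two
`J`-holomorphic branches through a point, one regular, either meet in isolation or have the same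
image germ; fact F3 of `JHolomorphicLocalIntersections.lean`, an input of McDuff's limit theorem
L1b) is PROVED from the single analytic atom
`Literature.Geometry.Symplectic.dbarInequality_zeroDichotomy` (zeros of solutions of
`|∂̄v| ≤ K|v|` are isolated or fill a neighbourhood — the Carleman–Bers–Vekua similarity
principle, Wendl Lectures Thm 2.50): `jHolomorphic_intersectionDichotomy_of_zeroDichotomy`
(registered helper). Steps: chart at the common point `x = G₂ 0` with the flat structure `Jc`
(`helper_chartJ`, `helper_jHolomorphic_chart`); J-adapted straightening `Φ` of the regular branch
(`helper_straightenFlatDisc`: `Φ (z, 0) = g₂ z`, `DΦ ∘ i = Jc ∘ DΦ` on the axis); the other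
branch `f := Φ⁻¹ ∘ g₁` is `M`-holomorphic for `M := DΦ⁻¹ ∘ Jc ∘ DΦ`, which is multiplication by
`i` on the axis, so (`helper_normalComponentInequality`) `|∂̄f²| ≤ K|f²|` near `0` and `f¹` is
holomorphic where `f² ≡ 0`; the atom splits: `f² ≡ 0` near `0` gives `G₁ = G₂ ∘ f¹` with `f¹`
holomorphic non-constant (the open mapping theorem yields both inclusions of images), `f² ≠ 0`
on a punctured neighbourhood gives isolation (`Φ` is injective on its source).
-/

noncomputable section

set_option linter.dupNamespace false

open scoped Manifold ContDiff Topology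
open Set Filter

namespace Summit.SmoothPoincare4.SmoothPoincare4.Theorems.WitnessCharge.PencilIncompleteness

open Literature.Geometry.Symplectic

/-- Chart expression of a smooth map `ℂ → V` is smooth on a ball mapped into the chart source. -/
theorem contDiffOn_extChartAt_comp_ball {V : Type} [TopologicalSpace V]
    [ChartedSpace (EuclideanSpace ℝ (Fin 4)) V] [IsManifold (𝓡 4) ∞ V]
    {G : ℂ → V} (hG : ContMDiff 𝓘(ℝ, ℂ) (𝓡 4) ∞ G) (x : V) {r : ℝ}
    (hball : Set.MapsTo G (Metric.ball (0 : ℂ) r) (chartAt (EuclideanSpace ℝ (Fin 4)) x).source) :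
    ContDiffOn ℝ ∞ (fun w : ℂ => extChartAt (𝓡 4) x (G w)) (Metric.ball (0 : ℂ) r) := by
  have h1 : ContMDiffOn 𝓘(ℝ, ℂ) 𝓘(ℝ, EuclideanSpace ℝ (Fin 4)) ∞
      (fun w : ℂ => extChartAt (𝓡 4) x (G w)) (Metric.ball (0 : ℂ) r) :=
    (contMDiffOn_extChartAt (I := 𝓡 4) (n := ∞) (x := x)).comp hG.contMDiffOn
      (fun w hw => hball hw)
  exact contMDiffOn_iff_contDiffOn.1 h1

/-- **F3 from the `∂̄`-inequality zero dichotomy (registered helper).** GIVEN the analytic atom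
`dbarInequality_zeroDichotomy` (similarity principle), McDuff's intersection dichotomy for two
`J`-holomorphic branches through a point, one of them regular
(`jHolomorphic_intersectionDichotomy`, fact F3) holds. Proof: in the chart at the common point,
straighten the regular branch to the axis with the structure standard along it
(`helper_straightenFlatDisc`); in these coordinates the other branch `f = (f¹, f²)` is holomorphic
for a structure `M` equal to `i` on the axis, so its normal component satisfies
`|∂̄f²| ≤ K|f²|` (`helper_normalComponentInequality`); the atom then says: either `f² ≡ 0` near `0`
— then `G₁ = G₂ ∘ f¹` near `0` with `f¹` holomorphic and non-constant, whence both inclusions of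
images (continuity, open mapping theorem) — or `f² ≠ 0` on a punctured neighbourhood — then the
intersection is isolated (`Φ` and `G₂` are injective near the point). -/
theorem jHolomorphic_intersectionDichotomy_of_zeroDichotomy :
    Literature.Geometry.Symplectic.dbarInequality_zeroDichotomy →
    Literature.Geometry.Symplectic.jHolomorphic_intersectionDichotomy := by
  intro hatom V _ _ _ _ _ J hJ2 hJs G₁ G₂ hG₁s hG₁J hG₂s hG₂J h0 hreg hnc
  -- ### the chart at the common point `x := G₂ 0` and the flat structure `Jc`
  obtain ⟨Jc, hJc_smooth, hJc_sq, hJc_eq⟩ :=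
    helper_chartJ V J hJ2 (helper_inTangentCoordinates_contMDiffOn V J hJs) (G₂ 0)
  set φ := extChartAt (𝓡 4) (G₂ 0) with hφ
  have hsrc_nhds : (chartAt (EuclideanSpace ℝ (Fin 4)) (G₂ 0)).source ∈ 𝓝 (G₂ 0) :=
    (chartAt (EuclideanSpace ℝ (Fin 4)) (G₂ 0)).open_source.mem_nhds
      (mem_chart_source (EuclideanSpace ℝ (Fin 4)) (G₂ 0))
  -- a radius on which both branches stay in the chart source
  have hpre₁ : G₁ ⁻¹' (chartAt (EuclideanSpace ℝ (Fin 4)) (G₂ 0)).source ∈ 𝓝 (0 : ℂ) :=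
    hG₁s.continuous.continuousAt (by rw [h0]; exact hsrc_nhds)
  have hpre₂ : G₂ ⁻¹' (chartAt (EuclideanSpace ℝ (Fin 4)) (G₂ 0)).source ∈ 𝓝 (0 : ℂ) :=
    hG₂s.continuous.continuousAt hsrc_nhds
  obtain ⟨r₀, hr₀, hr₀ball⟩ := Metric.mem_nhds_iff.1 (Filter.inter_mem hpre₁ hpre₂)
  have hsrc₁ : ∀ z ∈ Metric.ball (0 : ℂ) r₀, G₁ z ∈ (chartAt (EuclideanSpace ℝ (Fin 4)) (G₂ 0)).source :=
    fun z hz => (hr₀ball hz).1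
  have hsrc₂ : ∀ z ∈ Metric.ball (0 : ℂ) r₀, G₂ z ∈ (chartAt (EuclideanSpace ℝ (Fin 4)) (G₂ 0)).source :=
    fun z hz => (hr₀ball hz).2
  -- ### chart expressions `g₁`, `g₂`
  set g₁ : ℂ → EuclideanSpace ℝ (Fin 4) := fun z => φ (G₁ z) with hg₁
  set g₂ : ℂ → EuclideanSpace ℝ (Fin 4) := fun z => φ (G₂ z) with hg₂
  have hg₁s : ContDiffOn ℝ ∞ g₁ (Metric.ball (0 : ℂ) r₀) :=
    contDiffOn_extChartAt_comp_ball hG₁s (G₂ 0) hsrc₁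
  have hg₂s : ContDiffOn ℝ ∞ g₂ (Metric.ball (0 : ℂ) r₀) :=
    contDiffOn_extChartAt_comp_ball hG₂s (G₂ 0) hsrc₂
  have hg₁maps : Set.MapsTo g₁ (Metric.ball (0 : ℂ) r₀) φ.target := fun z hz =>
    φ.map_source (by rw [hφ, extChartAt_source]; exact hsrc₁ z hz)
  have hg₂maps : Set.MapsTo g₂ (Metric.ball (0 : ℂ) r₀) φ.target := fun z hz =>
    φ.map_source (by rw [hφ, extChartAt_source]; exact hsrc₂ z hz)
  have hg₁hol : ∀ z ∈ Metric.ball (0 : ℂ) r₀, ∀ ζ : ℂ,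
      fderiv ℝ g₁ z (Complex.I * ζ) = Jc (g₁ z) (fderiv ℝ g₁ z ζ) := by
    intro z hz ζ
    rw [hg₁, hJc_eq (G₁ z) (hsrc₁ z hz)]
    exact helper_jHolomorphic_chart V J (G₂ 0) G₁ z (hG₁s z) (hG₁J z) (hsrc₁ z hz) ζ
  have hg₂hol : ∀ z ∈ Metric.ball (0 : ℂ) r₀, ∀ ζ : ℂ,
      fderiv ℝ g₂ z (Complex.I * ζ) = Jc (g₂ z) (fderiv ℝ g₂ z ζ) := by
    intro z hz ζ
    rw [hg₂, hJc_eq (G₂ z) (hsrc₂ z hz)]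
    exact helper_jHolomorphic_chart V J (G₂ 0) G₂ z (hG₂s z) (hG₂J z) (hsrc₂ z hz) ζ
  have hg₂reg : Function.Injective (fderiv ℝ g₂ 0) := by
    intro a b hab
    have h1 := fderiv_extChartAt_comp_apply (x₀ := G₂ 0) (hG₂s 0) (hsrc₂ 0 (Metric.mem_ball_self hr₀)) a
    have h2 := fderiv_extChartAt_comp_apply (x₀ := G₂ 0) (hG₂s 0) (hsrc₂ 0 (Metric.mem_ball_self hr₀)) b
    have hab' : fderiv ℝ (fun w : ℂ => extChartAt (𝓡 4) (G₂ 0) (G₂ w)) 0 a =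
        fderiv ℝ (fun w : ℂ => extChartAt (𝓡 4) (G₂ 0) (G₂ w)) 0 b := hab
    rw [h1, h2] at hab'
    exact hreg (mfderiv_extChartAt_injective (hsrc₂ 0 (Metric.mem_ball_self hr₀)) hab')
  have hg0 : g₁ 0 = g₂ 0 := by simp only [hg₁, hg₂, h0]
  -- ### straighten the regular branch
  obtain ⟨Φ, ρ₂, hρ₂, hρ₂r, hΦsrc, hΦaxis, hΦs, hΦsymm_s, hΦbij, hΦJ⟩ :=
    helper_straightenFlatDisc φ.target (isOpen_extChartAt_target (I := 𝓡 4) (G₂ 0)) Jc hJc_smooth hJc_sq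
      g₂ r₀ hr₀ hg₂s hg₂maps hg₂hol hg₂reg
  have h00 : ((0 : ℂ), (0 : ℂ)) ∈ Φ.source := hΦsrc (0, 0) (by simpa using hρ₂) (by simpa using hρ₂)
  have hΦ00 : Φ (0, 0) = g₁ 0 := by rw [hg0]; exact hΦaxis 0 (by simpa using hρ₂)
  -- the derivative of `Φ` at a source point as a continuous linear equivalence
  have hΦderiv : ∀ q ∈ Φ.source, ∃ e : (ℂ × ℂ) ≃L[ℝ] EuclideanSpace ℝ (Fin 4),
      (e : ℂ × ℂ →L[ℝ] EuclideanSpace ℝ (Fin 4)) = fderiv ℝ Φ q ∧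
      HasFDerivAt Φ (e : ℂ × ℂ →L[ℝ] EuclideanSpace ℝ (Fin 4)) q := by
    intro q hq
    have hd : DifferentiableAt ℝ Φ q :=
      (hΦs.differentiableOn (by simp)).differentiableAt (Φ.open_source.mem_nhds hq)
    set e : (ℂ × ℂ) ≃L[ℝ] EuclideanSpace ℝ (Fin 4) :=
      (LinearEquiv.ofBijective (fderiv ℝ Φ q : ℂ × ℂ →ₗ[ℝ] EuclideanSpace ℝ (Fin 4))
        (hΦbij q hq)).toContinuousLinearEquiv with he
    have hecoe : (e : ℂ × ℂ →L[ℝ] EuclideanSpace ℝ (Fin 4)) = fderiv ℝ Φ q :=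
      ContinuousLinearMap.ext fun w => rfl
    exact ⟨e, hecoe, hecoe ▸ hd.hasFDerivAt⟩
  -- ### the other branch in the new coordinates
  have hg₁cont : ContinuousAt g₁ 0 :=
    (hg₁s.continuousOn.continuousWithinAt (Metric.mem_ball_self hr₀)).continuousAt
      (Metric.ball_mem_nhds _ hr₀)
  have htgt_nhds : Φ.target ∈ 𝓝 (g₁ 0) := by
    rw [← hΦ00]; exact Φ.open_target.mem_nhds (Φ.map_source h00)
  -- `U`: source points with small first coordinate (where the structure on the axis is standard)
  set U : Set (ℂ × ℂ) := (Φ.source ∩ Φ ⁻¹' φ.target) ∩ {q | ‖q.1‖ < ρ₂} with hU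
  have hUopen : IsOpen U :=
    (Φ.isOpen_inter_preimage (isOpen_extChartAt_target (I := 𝓡 4) (G₂ 0))).inter
      (isOpen_lt (continuous_norm.comp continuous_fst) continuous_const)
  have hU0 : ((0 : ℂ), (0 : ℂ)) ∈ U :=
    ⟨⟨h00, by rw [Set.mem_preimage, hΦ00]; exact hg₁maps (Metric.mem_ball_self hr₀)⟩, by simpa using hρ₂⟩
  -- `f := Φ.symm ∘ g₁` on a small ball
  set f : ℂ → ℂ × ℂ := fun z => Φ.symm (g₁ z) with hf
  have hf0 : f 0 = 0 := by
    show Φ.symm (g₁ 0) = (0, 0)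
    rw [← hΦ00]; exact Φ.left_inv h00
  have hg₁0tgt : g₁ 0 ∈ Φ.target := by rw [← hΦ00]; exact Φ.map_source h00
  have hfcont0 : ContinuousAt f 0 := (Φ.continuousAt_symm hg₁0tgt).comp hg₁cont
  have hfpre : f ⁻¹' U ∈ 𝓝 (0 : ℂ) := hfcont0 (by rw [hf0]; exact hUopen.mem_nhds hU0)
  have hg₁pre : g₁ ⁻¹' Φ.target ∈ 𝓝 (0 : ℂ) := hg₁cont htgt_nhds
  obtain ⟨r₁, hr₁, hr₁ball⟩ := Metric.mem_nhds_iff.1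
    (Filter.inter_mem (Filter.inter_mem hfpre hg₁pre) (Metric.ball_mem_nhds (0 : ℂ) hr₀))
  have hfU : ∀ z ∈ Metric.ball (0 : ℂ) r₁, f z ∈ U := fun z hz => (hr₁ball hz).1.1
  have hfsrc : ∀ z ∈ Metric.ball (0 : ℂ) r₁, f z ∈ Φ.source := fun z hz => (hfU z hz).1.1
  have hg₁tgt : ∀ z ∈ Metric.ball (0 : ℂ) r₁, g₁ z ∈ Φ.target := fun z hz => (hr₁ball hz).1.2
  have hr₁r₀ : Metric.ball (0 : ℂ) r₁ ⊆ Metric.ball (0 : ℂ) r₀ := fun z hz => (hr₁ball hz).2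
  have hΦf : ∀ z ∈ Metric.ball (0 : ℂ) r₁, Φ (f z) = g₁ z := fun z hz => Φ.right_inv (hg₁tgt z hz)
  have hfs : ContDiffOn ℝ ∞ f (Metric.ball (0 : ℂ) r₁) :=
    hΦsymm_s.comp (hg₁s.mono hr₁r₀) (fun z hz => hg₁tgt z hz)
  -- ### the structure `M` in the new coordinates
  set M : ℂ × ℂ → (ℂ × ℂ →L[ℝ] ℂ × ℂ) := fun q =>
    (fderiv ℝ Φ.symm (Φ q)).comp ((Jc (Φ q)).comp (fderiv ℝ Φ q)) with hM
  have hMs : ContDiffOn ℝ ∞ M U := by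
    have hU_src : U ⊆ Φ.source := fun q hq => hq.1.1
    have h1 : ContDiffOn ℝ ∞ (fun q => fderiv ℝ Φ q) U :=
      (hΦs.fderiv_of_isOpen Φ.open_source (by simp)).mono hU_src
    have h2 : ContDiffOn ℝ ∞ (fun q => Jc (Φ q)) U :=
      hJc_smooth.comp (hΦs.mono hU_src) (fun q hq => hq.1.2)
    have h3 : ContDiffOn ℝ ∞ (fun q => fderiv ℝ Φ.symm (Φ q)) U :=
      (hΦsymm_s.fderiv_of_isOpen Φ.open_target (by simp)).comp (hΦs.mono hU_src)
        (fun q hq => Φ.map_source (hU_src hq))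
    exact h3.clm_comp (h2.clm_comp h1)
  have hMaxis : ∀ q₁ : ℂ, (q₁, (0 : ℂ)) ∈ U → ∀ w : ℂ × ℂ, M (q₁, 0) w = Complex.I • w := by
    intro q₁ hq₁ w
    obtain ⟨e, hecoe, hederiv⟩ := hΦderiv (q₁, 0) hq₁.1.1
    have hq₁n : ‖q₁‖ < ρ₂ := hq₁.2
    have hsymm : HasFDerivAt Φ.symm (e.symm : EuclideanSpace ℝ (Fin 4) →L[ℝ] ℂ × ℂ) (Φ (q₁, 0)) :=
      Φ.hasFDerivAt_symm (Φ.map_source hq₁.1.1) (by rw [Φ.left_inv hq₁.1.1]; exact hederiv)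
    show (fderiv ℝ Φ.symm (Φ (q₁, 0))) (Jc (Φ (q₁, 0)) (fderiv ℝ Φ (q₁, 0) w)) = Complex.I • w
    rw [hsymm.fderiv, hΦaxis q₁ hq₁n, ← hΦJ q₁ hq₁n w, ← hecoe]
    simp
  -- ### the equation for `f`
  have hfhol : ∀ z ∈ Metric.ball (0 : ℂ) r₁, ∀ ζ : ℂ,
      fderiv ℝ f z (Complex.I * ζ) = M (f z) (fderiv ℝ f z ζ) := by
    intro z hz ζ
    have hfz : f z ∈ Φ.source := hfsrc z hz
    obtain ⟨e, hecoe, hederiv⟩ := hΦderiv (f z) hfz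
    have hfd : DifferentiableAt ℝ f z :=
      (hfs.differentiableOn (by simp)).differentiableAt (Metric.isOpen_ball.mem_nhds hz)
    -- `g₁ = Φ ∘ f` near `z`
    have hev : (fun w => Φ (f w)) =ᶠ[𝓝 z] g₁ := by
      filter_upwards [Metric.isOpen_ball.mem_nhds hz] with w hw
      exact hΦf w hw
    have hchain : HasFDerivAt g₁ ((e : ℂ × ℂ →L[ℝ] EuclideanSpace ℝ (Fin 4)).comp (fderiv ℝ f z)) z :=
      (hederiv.comp z hfd.hasFDerivAt).congr_of_eventuallyEq hev.symm
    have hg₁d : fderiv ℝ g₁ z = (e : ℂ × ℂ →L[ℝ] EuclideanSpace ℝ (Fin 4)).comp (fderiv ℝ f z) :=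
      hchain.fderiv
    have key := hg₁hol z (hr₁r₀ hz) ζ
    rw [hg₁d, ContinuousLinearMap.comp_apply, ContinuousLinearMap.comp_apply] at key
    -- `e (df (iζ)) = Jc (g₁ z) (e (df ζ))`; apply `e.symm`
    have key2 : fderiv ℝ f z (Complex.I * ζ) = e.symm (Jc (g₁ z) (e (fderiv ℝ f z ζ))) := by
      have := congrArg e.symm key
      simpa using this
    rw [key2]
    have hsymm : HasFDerivAt Φ.symm (e.symm : EuclideanSpace ℝ (Fin 4) →L[ℝ] ℂ × ℂ) (Φ (f z)) :=
      Φ.hasFDerivAt_symm (Φ.map_source hfz) (by rw [Φ.left_inv hfz]; exact hederiv)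
    show _ = (fderiv ℝ Φ.symm (Φ (f z))) (Jc (Φ (f z)) (fderiv ℝ Φ (f z) (fderiv ℝ f z ζ)))
    rw [hsymm.fderiv, hΦf z hz, ← hecoe]
    rfl
  -- ### the normal component inequality and the atom
  obtain ⟨⟨K, ρ₃, hρ₃, hρ₃r, hineq⟩, htang⟩ :=
    helper_normalComponentInequality U hUopen hU0 M hMs hMaxis f r₁ hr₁ hfs
      (fun z hz => hfU z hz) hf0 hfhol
  have hv1 : ContDiffOn ℝ 1 (fun z => (f z).2) (Metric.ball (0 : ℂ) ρ₃) :=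
    ((hfs.mono (Metric.ball_subset_ball hρ₃r)).of_le (by norm_cast)).snd
  have hdich := hatom ℂ 0 ρ₃ K hρ₃ (fun z => (f z).2) hv1 hineq (by simp [hf0])
  -- ### `G₁ = G₂ ∘ f¹` where `f² = 0`, and injectivity facts
  have hkey : ∀ z ∈ Metric.ball (0 : ℂ) r₁, (f z).2 = 0 → G₁ z = G₂ ((f z).1) := by
    intro z hz hz2
    have hfn : ‖(f z).1‖ < ρ₂ := (hfU z hz).2
    have h1 : g₁ z = g₂ ((f z).1) := by
      rw [← hΦf z hz, ← hΦaxis _ hfn]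
      congr 1
      exact Prod.ext rfl hz2
    have hmem₁ : G₁ z ∈ (extChartAt (𝓡 4) (G₂ 0)).source := by
      rw [extChartAt_source]; exact hsrc₁ z (hr₁r₀ hz)
    have hmem₂ : G₂ ((f z).1) ∈ (extChartAt (𝓡 4) (G₂ 0)).source := by
      rw [extChartAt_source]
      exact hsrc₂ _ (mem_ball_zero_iff.2 (hfn.trans_le hρ₂r))
    exact (extChartAt (𝓡 4) (G₂ 0)).injOn hmem₁ hmem₂ h1
  rcases hdich with hA | hB
  · -- ### branch A: same image germ
    right
    -- `f¹` is holomorphic near `0` and not locally constant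
    have hhol : ∀ᶠ z in 𝓝 (0 : ℂ), DifferentiableAt ℂ (fun z => (f z).1) z := htang hA
    obtain ⟨ε₁, hε₁, hε₁ball⟩ : ∃ ε₁ : ℝ, 0 < ε₁ ∧ ∀ z ∈ Metric.ball (0 : ℂ) ε₁,
        (f z).2 = 0 ∧ z ∈ Metric.ball (0 : ℂ) r₁ := by
      obtain ⟨ε, hε, hεb⟩ := Metric.mem_nhds_iff.1 (hA.and (Metric.ball_mem_nhds (0 : ℂ) hr₁))
      exact ⟨ε, hε, fun z hz => hεb hz⟩
    set h : ℂ → ℂ := fun z => (f z).1 with hh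
    have hh0 : h 0 = 0 := by simp [hh, hf0]
    have hG₁eq : ∀ z ∈ Metric.ball (0 : ℂ) ε₁, G₁ z = G₂ (h z) := fun z hz =>
      hkey z (hε₁ball z hz).2 (hε₁ball z hz).1
    have han : AnalyticAt ℂ h 0 := by
      obtain ⟨ε, hε, hεb⟩ := Metric.mem_nhds_iff.1 hhol
      have hd : DifferentiableOn ℂ h (Metric.ball (0 : ℂ) ε) := fun z hz =>
        (hεb hz).differentiableWithinAt
      exact hd.analyticAt (Metric.ball_mem_nhds _ hε)
    have hcont_h : ContinuousAt h 0 := han.continuousAt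
    rcases han.eventually_constant_or_nhds_le_map_nhds with hconst | hopen
    · -- `h` locally constant ⇒ `G₁` locally constant: contradiction
      exfalso
      apply hnc
      -- show `∀ᶠ z in 𝓝 0, G₁ z = G₁ 0` i.e. `¬ ∃ᶠ z, G₁ z ≠ G₁ 0`
      have : ∀ᶠ z in 𝓝 (0 : ℂ), G₁ z = G₁ 0 := by
        filter_upwards [hconst, Metric.ball_mem_nhds (0 : ℂ) hε₁] with z hz hzb
        rw [hG₁eq z hzb, hz, hh0, h0]
      exact this.mono fun z hz => not_not.2 hz
    · intro ρ hρ
      -- first inclusion radius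
      have hpre_h : h ⁻¹' Metric.ball (0 : ℂ) ρ ∈ 𝓝 (0 : ℂ) :=
        hcont_h (by rw [hh0]; exact Metric.ball_mem_nhds _ hρ)
      obtain ⟨ρa, hρa, hρab⟩ := Metric.mem_nhds_iff.1
        (Filter.inter_mem hpre_h (Metric.ball_mem_nhds (0 : ℂ) hε₁))
      -- second inclusion radius: `h '' ball 0 ρ'' ∈ 𝓝 0` for `ρ'' := min ρ ε₁`
      set ρ'' : ℝ := min ρ ε₁ with hρ''
      have hρ''pos : 0 < ρ'' := lt_min hρ hε₁
      have himage : h '' Metric.ball (0 : ℂ) ρ'' ∈ 𝓝 (0 : ℂ) := by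
        have h1 : h '' Metric.ball (0 : ℂ) ρ'' ∈ 𝓝 (h 0) := by
          refine hopen ?_
          rw [Filter.mem_map]
          exact Filter.mem_of_superset (Metric.ball_mem_nhds _ hρ''pos)
            (Set.subset_preimage_image _ _)
        rwa [hh0] at h1
      obtain ⟨ρb, hρb, hρbb⟩ := Metric.mem_nhds_iff.1 himage
      refine ⟨min ρa ρb, lt_min hρa hρb, ?_, ?_⟩
      · rintro y ⟨z, hz, rfl⟩
        have hz' : z ∈ Metric.ball (0 : ℂ) ρa := Metric.ball_subset_ball (min_le_left _ _) hz
        have ⟨hz1, hz2⟩ := hρab hz'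
        exact ⟨h z, hz1, (hG₁eq z hz2).symm⟩
      · rintro y ⟨t, ht, rfl⟩
        have ht' : t ∈ Metric.ball (0 : ℂ) ρb := Metric.ball_subset_ball (min_le_right _ _) ht
        obtain ⟨z, hz, hzt⟩ := hρbb ht'
        have hzρ : z ∈ Metric.ball (0 : ℂ) ρ := Metric.ball_subset_ball (min_le_left _ _) hz
        have hzε : z ∈ Metric.ball (0 : ℂ) ε₁ := Metric.ball_subset_ball (min_le_right _ _) hz
        exact ⟨z, hzρ, by rw [hG₁eq z hzε, hzt]⟩
  · -- ### branch B: isolated intersection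
    left
    obtain ⟨ε₂, hε₂, hε₂ball⟩ : ∃ ε₂ : ℝ, 0 < ε₂ ∧ ∀ z ∈ Metric.ball (0 : ℂ) ε₂, z ≠ 0 → (f z).2 ≠ 0 := by
      rw [eventually_nhdsWithin_iff] at hB
      obtain ⟨ε, hε, hεb⟩ := Metric.mem_nhds_iff.1 hB
      exact ⟨ε, hε, fun z hz hz0 => hεb hz hz0⟩
    refine ⟨min (min ε₂ r₁) ρ₂, lt_min (lt_min hε₂ hr₁) hρ₂, fun s hs t ht hst => ?_⟩
    have hsε : s ∈ Metric.ball (0 : ℂ) ε₂ :=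
      Metric.ball_subset_ball ((min_le_left _ _).trans (min_le_left _ _)) hs
    have hsr : s ∈ Metric.ball (0 : ℂ) r₁ :=
      Metric.ball_subset_ball ((min_le_left _ _).trans (min_le_right _ _)) hs
    have htρ : ‖t‖ < ρ₂ := by
      have := Metric.ball_subset_ball (min_le_right _ _) ht
      simpa using this
    have htr : t ∈ Metric.ball (0 : ℂ) r₀ := mem_ball_zero_iff.2 (htρ.trans_le hρ₂r)
    -- `Φ (f s) = g₁ s = g₂ t = Φ (t, 0)`
    have h1 : Φ (f s) = Φ (t, 0) := by
      rw [hΦf s hsr, hΦaxis t htρ]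
      show φ (G₁ s) = φ (G₂ t)
      rw [hst]
    have ht0src : (t, (0 : ℂ)) ∈ Φ.source := hΦsrc (t, 0) htρ (by simpa using hρ₂)
    have h2 : f s = (t, 0) := Φ.injOn (hfsrc s hsr) ht0src h1
    have hs0 : s = 0 := by
      by_contra hne
      exact hε₂ball s hsε hne (by rw [h2])
    refine ⟨hs0, ?_⟩
    subst hs0
    rw [hf0] at h2
    exact (congrArg Prod.fst h2).symm

end Summit.SmoothPoincare4.SmoothPoincare4.Theorems.WitnessCharge.PencilIncompleteness
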